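import Literature.NumberTheory.Sieve.MatomakiRadziwillLemma3ComplexBound
import Literature.NumberTheory.LFunctions.MatomakiRadziwillTaoSiftedInputs
import Literature.NumberTheory.LFunctions.TwistedPrimeSumTail
import Literature.NumberTheory.Sieve.MatomakiRadziwillProp1CoefU3
import Literature.NumberTheory.Sieve.MatomakiRadziwillProp1
import HarnessLib

/-!
# Matomäki–Radziwiłł–Tao 2015, Lemma A.4 for the sifted copies: the Halász input `hR` of the range `𝒯₂`

Topic `Literature/NumberTheory/LFunctions`.  Everything in this file is PROVED (the main theorem conditionally on the
named fact `Khale2024_zeroFreeRegion`); no definitions, no named facts.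

In the proof of Proposition A.3 of K. Matomäki, M. Radziwiłł, T. Tao, *An averaged form of Chowla's conjecture*,
Algebra & Number Theory 9 (2015), Appendix A, the range `𝒯₂ = {|t − t₁| ≥ (log X)^{1/16}}` is treated "in exactly
the same way as [MR]" with Lemma 3 of Matomäki–Radziwiłł replaced by Lemma A.4 (the same bound for complex `f`).  In
the tree's assembly of MR's Proposition 1 for general coefficients (`Sieve.prop1_coef_of_lemma11`,
`MatomakiRadziwillProp1CoefAssembly.lean`) that input is the hypothesis `hR`: a pointwise bound
`|R_{v,H}(1+it)| ≤ 2^J · 3 C₃ L^{1/50−1/16}` for the cofactor polynomials of the `𝒰`-part.  This file proves `hR` for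
`a = f 1_𝒮`, `f` completely multiplicative and `1`-bounded, `t₁` the minimiser of `u ↦ 𝔻(f, n^{iu}; X)²` on `|u| ≤ X`,
and `t ∈ [0, X/2]` with `|t − t₁| ≥ (log X)^{1/16}`:

* `blockCofactorPoly_memCoef_eq` — Lemma 5 inside `R_{v,H}`: `R_{v,H}[f 1_𝒮] = ∑_𝒥 (−1)^{#𝒥} R[f g_𝒥]`;
* `pmul_g_sieveInd_prime`, `pmul_g_props` — `f g_𝒥 1_{S-free}` is a sifted copy of `f`; `f g_𝒥` is multiplicative
  and `1`-bounded;
* `floor_le_Msum` — the distance floor on the fibres of MR's Lemma 3 for the sifted twists of `f g_𝒥`, from the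
  Granville–Soundararajan device relative to `t₁` (`MatomakiRadziwillTaoSiftedInputs.lean`) and the Vinogradov–Korobov
  prime tail (`TwistedPrimeSumTail.pretentiousDistSq_one_twist_tail_ge`, here at `θ = 27/40`);
  `exp_neg_floor_le` — `e^{-(39/40) M₀} ≤ K_M L^{-1/16}` (`(39/40)(13/40)(√2−1)/2 = 0.0656… ≥ 1/16`);
  `sum_inv_prime_tail_le_of_log` — the prime tail paid for moving the minimiser down to the fibre heights;
* `exists_cofactor_bound` — **the bound `hR`**, from `MatomakiRadziwillL3C.lemma3_complex_of_floor` at the scale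
  `X' = X e^{-v/H}` and `MatomakiRadziwillU.lemma3_rhs_le`.

## References
* K. Matomäki, M. Radziwiłł, T. Tao, Algebra & Number Theory 9 (2015) (arXiv:1503.05121), Appendix A, proof of
  Proposition A.3 and Lemma A.4. [cite: MatomakiRadziwillTao2015, Appendix A, Lemma A.4]
* K. Matomäki, M. Radziwiłł, Ann. of Math. (2) 183 (2016), Lemmas 3 and 5, §8.3. [cite: MatomakiRadziwillAnnals2016, Lemma 3]
* T. Khale, Q. J. Math. 75 (2024), Theorem 1.1. [cite: Khale2024, Theorem 1.1]
-/

noncomputable section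

open Finset Real Complex Filter
open scoped ComplexConjugate

namespace Literature.NumberTheory.LFunctions

namespace MRT2015

open Sieve (SieveIntervalSystem minPretentiousDistSq pretentiousDistSq blockCofactorPoly primeDivisorsIn)
open Sieve.MatomakiRadziwillL4A (toComplexAF toComplexAF_apply twistAF Msum)
open Sieve.MatomakiRadziwillL3 (sieveInd sieveInd_prime primesPQ primesPQ_prime Ystar)
open Sieve.MatomakiRadziwillL3C (siftedTwistC)

variable {η X₀ : ℝ}

/-! ### A prime tail, complete multiplicativity, Lemma 5 for complex coefficients, sifted copies -/

/-- `∑_{Y < p ≤ X} 1/p ≤ 16` when `4 ≤ Y ≤ X` and `log X ≤ 16 log Y` (Mertens both ways, as in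
`Sieve.HalaszMT.sum_inv_prime_tail_le`). [folklore] -/
theorem sum_inv_prime_tail_le_of_log {Y X : ℝ} (hY4 : 4 ≤ Y) (hYX : Y ≤ X) (hlog : Real.log X ≤ 16 * Real.log Y) :
    ∑ p ∈ (Finset.Ioc ⌊Y⌋₊ ⌊X⌋₊).filter Nat.Prime, (1 : ℝ) / p ≤ 16 := by
  have hx3 : 3 ≤ X := by linarith
  have hup := Halasz.sum_primesLE_inv_le hx3
  have hlow := MertensBound.loglog_sub_loglog_le_sum_inv_prime (P := 2) le_rfl (by linarith : (2:ℝ) ≤ Y)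
  have hfl2 : ⌊(2:ℝ)⌋₊ = 2 := by norm_num
  rw [hfl2] at hlow
  have hsplit : ∑ p ∈ Nat.primesLE ⌊X⌋₊, (1 : ℝ) / p =
      ∑ p ∈ Nat.primesLE ⌊Y⌋₊, (1 : ℝ) / p + ∑ p ∈ (Finset.Ioc ⌊Y⌋₊ ⌊X⌋₊).filter Nat.Prime, (1 : ℝ) / p := by
    rw [Sieve.HalaszMT.primesLE_eq_union hYX, Finset.sum_union (Sieve.HalaszMT.disjoint_primesLE_tail Y X)]
  have hsub : ∑ p ∈ (Finset.Ioc 2 ⌊Y⌋₊).filter Nat.Prime, (1 : ℝ) / p ≤ ∑ p ∈ Nat.primesLE ⌊Y⌋₊, (1 : ℝ) / p := by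
    refine Finset.sum_le_sum_of_subset_of_nonneg (fun p hp => ?_) fun p _ _ => by positivity
    simp only [Finset.mem_filter, Finset.mem_Ioc] at hp
    exact Nat.mem_primesLE.2 ⟨hp.1.2, hp.2⟩
  have hlog2 : (0.6931471803 : ℝ) < Real.log 2 := Real.log_two_gt_d9
  have hlog2' : Real.log 2 < 0.6931471808 := Real.log_two_lt_d9
  have hly : 1 < Real.log Y := by
    rw [← Real.log_exp 1]
    exact Real.log_lt_log (Real.exp_pos 1) (by have := Real.exp_one_lt_d9; linarith)
  have hll : Real.log (Real.log X) ≤ Real.log 16 + Real.log (Real.log Y) := by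
    rw [← Real.log_mul (by norm_num) (by linarith)]
    exact Real.log_le_log (Real.log_pos (by linarith)) hlog
  have hlog16 : Real.log 16 = 4 * Real.log 2 := by
    rw [show (16:ℝ) = 2 ^ 4 by norm_num, Real.log_pow]; norm_num
  have hll2 : Real.log (Real.log 2) ≤ 0 := Real.log_nonpos (by linarith) (by linarith)
  have h6 : 6 / Real.log 2 ≤ 8.7 := by
    rw [div_le_iff₀ (by linarith)]; linarith
  linarith

/-- A completely multiplicative arithmetic function with `f 1 = 1` is multiplicative. [folklore] -/
theorem isMultiplicative_of_cm {f : ArithmeticFunction ℂ} (hf : ∀ m n : ℕ, f (m * n) = f m * f n) (hf1 : f 1 = 1) :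
    f.IsMultiplicative :=
  ⟨hf1, fun _ => hf _ _⟩

/-- **Lemma 5 inside the cofactor polynomial, complex coefficients**: for `a = f 1_𝒮`,
`R_{v,H}(1+it) = ∑_{𝒥 ⊆ [1,J]} (-1)^{#𝒥} ∑_{X' ≤ m ≤ 2X'} g_𝒥(m) f(m) m^{-1-it}/(ω(m)+1)`, `X' = X e^{-v/H}`.
[cite: MatomakiRadziwillAnnals2016, Lemma 5 and §8.3] -/
theorem blockCofactorPoly_memCoef_eq (I : SieveIntervalSystem η X₀) (f : ℕ → ℂ) (X P Q H : ℝ) (v : ℕ) (t : ℝ) :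
    blockCofactorPoly (fun n : ℕ => if I.Mem n then f n else 0) X P Q H v t =
      ∑ 𝒥 ∈ (Icc 1 I.J).powerset, ((-1 : ℝ) ^ #𝒥) •
        ∑ m ∈ Icc ⌈X * Real.exp (-(v / H))⌉₊ ⌊2 * (X * Real.exp (-(v / H)))⌋₊,
          ((I.g 𝒥 m : ℂ) * f m) * (m : ℂ) ^ (-(1 + (t : ℂ) * Complex.I)) / ((primeDivisorsIn P Q m : ℂ) + 1) := by
  classical
  unfold blockCofactorPoly
  rw [mul_assoc]
  set s := Icc ⌈X * Real.exp (-(v / H))⌉₊ ⌊2 * (X * Real.exp (-(v / H)))⌋₊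
  have h1 : ∑ m ∈ s, (if I.Mem m then f m else 0) * (m : ℂ) ^ (-(1 + (t : ℂ) * Complex.I)) /
        ((primeDivisorsIn P Q m : ℂ) + 1) =
      ∑ m ∈ s.filter I.Mem, f m * (m : ℂ) ^ (-(1 + (t : ℂ) * Complex.I)) / ((primeDivisorsIn P Q m : ℂ) + 1) := by
    rw [sum_filter]
    refine sum_congr rfl fun m _ => ?_
    split_ifs <;> simp
  rw [h1, I.sum_filter_mem_eq s]
  refine sum_congr rfl fun 𝒥 _ => ?_
  congr 1
  refine sum_congr rfl fun m _ => ?_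
  rw [Complex.real_smul]
  ring

/-- The functions `f g_𝒥 · 1_{S-free}` are sifted copies of `f`: at a prime `p` their value is `f(p)` or `0`.
[folklore] -/
theorem pmul_g_sieveInd_prime (I : SieveIntervalSystem η X₀) (f : ArithmeticFunction ℂ) (𝒥 : Finset ℕ)
    {S : Finset ℕ} (hS : ∀ p ∈ S, p.Prime) {p : ℕ} (hp : p.Prime) :
    ((f.pmul (toComplexAF (I.g 𝒥))).pmul (sieveInd S)) p = f p ∨
      ((f.pmul (toComplexAF (I.g 𝒥))).pmul (sieveInd S)) p = 0 := by
  rw [ArithmeticFunction.pmul_apply, ArithmeticFunction.pmul_apply, toComplexAF_apply,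
    I.g_apply_of_ne_zero 𝒥 hp.ne_zero, sieveInd_prime hS hp]
  by_cases h1 : I.Avoids 𝒥 p <;> by_cases h2 : p ∈ S <;> simp [h1, h2]

/-- `f g_𝒥` is multiplicative and `1`-bounded for completely multiplicative `1`-bounded `f`. [folklore] -/
theorem pmul_g_props (I : SieveIntervalSystem η X₀) {f : ArithmeticFunction ℂ} (hf : ∀ m n : ℕ, f (m * n) = f m * f n)
    (hf1 : f 1 = 1) (hfb : ∀ n, ‖f n‖ ≤ 1) (𝒥 : Finset ℕ) :
    (f.pmul (toComplexAF (I.g 𝒥))).IsMultiplicative ∧ ∀ n, ‖(f.pmul (toComplexAF (I.g 𝒥))) n‖ ≤ 1 := by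
  refine ⟨(isMultiplicative_of_cm hf hf1).pmul
    (Sieve.MatomakiRadziwillL4A.isMultiplicative_toComplexAF (I.isMultiplicative_g 𝒥)), fun n => ?_⟩
  rw [ArithmeticFunction.pmul_apply, norm_mul]
  have h1 := hfb n
  have h2 := Sieve.MatomakiRadziwillL4A.norm_toComplexAF_le (I.abs_g_le_one 𝒥) n
  exact mul_le_one₀ h1 (norm_nonneg _) h2

/-! ### The distance floor for the sifted twists of `f g_𝒥` -/

/-- **The floor `M₀` on the fibres.**  Let `|f| ≤ 1`, `t₁` a minimiser of `u ↦ 𝔻(f, n^{iu}; X)²` on `|u| ≤ X`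
(`|t₁| ≤ X`), `0 ≤ t` with `t + 2T_H ≤ X` and `|t − t₁| ≥ 2T_H + 2`, and suppose the Vinogradov–Korobov prime tail at
the scale `2X` with exponent `θ` (`hKh`, the conclusion of `TwistedPrimeSumTail.pretentiousDistSq_one_twist_tail_ge`).
If `exp((log 2X)^θ) ≤ Y_low ≤ X`, `Y_low ≥ 4`, `log X ≤ 16 log Y_low` and `B₀ ≤ log log Y − θ log log 2X − 6` for
`Y ∈ [Y_low, X]`, then for every `S ⊆` primes, every `𝒥`, all heights `Y ≥ Y_low` and `|y| ≤ 2T_H`: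
`((√2−1)/2) B₀ − 16 ≤ Msum (siftedTwistC (f g_𝒥) S t) Y y`.
[cite: MatomakiRadziwillTao2015, Appendix A, Lemma A.4] -/
theorem floor_le_Msum {f : ArithmeticFunction ℂ} (hfb : ∀ n, ‖f n‖ ≤ 1) (I : SieveIntervalSystem η X₀) (𝒥 : Finset ℕ)
    {S : Finset ℕ} (hS : ∀ p ∈ S, p.Prime) {X Ylow θ B₀ t₁ t TH : ℝ}
    (hKh : ∀ τ' : ℝ, 1 ≤ |τ'| → |τ'| ≤ 2 * X → ∀ Y : ℝ, Real.exp (Real.log (2 * X) ^ θ) ≤ Y → Y ≤ 2 * X →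
      Real.log (Real.log Y) - θ * Real.log (Real.log (2 * X)) - 6 ≤
        pretentiousDistSq 1 (fun n : ℕ => (n : ℂ) ^ ((τ' : ℂ) * Complex.I)) Y -
          pretentiousDistSq 1 (fun n : ℕ => (n : ℂ) ^ ((τ' : ℂ) * Complex.I)) (Real.exp (Real.log (2 * X) ^ θ) - 1))
    (hmin : ∀ u : ℝ, |u| ≤ X → pretentiousDistSq f (fun n : ℕ => (n : ℂ) ^ ((t₁ : ℂ) * Complex.I)) X ≤
      pretentiousDistSq f (fun n : ℕ => (n : ℂ) ^ ((u : ℂ) * Complex.I)) X)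
    (ht₁ : |t₁| ≤ X) (ht0 : 0 ≤ t) (htX : t + 2 * TH ≤ X) (hfar : 2 * TH + 2 ≤ |t - t₁|)
    (hYlowexp : Real.exp (Real.log (2 * X) ^ θ) ≤ Ylow) (hYlow4 : 4 ≤ Ylow) (hYlowX : Ylow ≤ X)
    (hlog : Real.log X ≤ 16 * Real.log Ylow)
    (hB₀ : ∀ Y : ℝ, Ylow ≤ Y → Y ≤ X → B₀ ≤ Real.log (Real.log Y) - θ * Real.log (Real.log (2 * X)) - 6) :
    ∀ Y : ℝ, Ylow ≤ Y → ∀ y : ℝ, |y| ≤ 2 * TH →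
      (Real.sqrt 2 - 1) / 2 * B₀ - 16 ≤ Msum (siftedTwistC (f.pmul (toComplexAF (I.g 𝒥))) S t) Y y := by
  intro Y hY y hy
  set fJ := f.pmul (toComplexAF (I.g 𝒥)) with hfJ
  set φ := fJ.pmul (sieveInd S) with hφ
  have hsift : siftedTwistC fJ S t = twistAF φ t := rfl
  have hφb : ∀ n, ‖twistAF φ t n‖ ≤ 1 := by
    intro n
    refine Sieve.MatomakiRadziwillL4A.norm_twistAF_le (fun m => ?_) t n
    rw [hφ, ArithmeticFunction.pmul_apply, norm_mul, hfJ, ArithmeticFunction.pmul_apply, norm_mul]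
    have h1 := hfb m
    have h2 := Sieve.MatomakiRadziwillL4A.norm_toComplexAF_le (I.abs_g_le_one 𝒥) m
    have h3 := Sieve.MatomakiRadziwillL3.norm_sieveInd_le S m
    exact mul_le_one₀ (mul_le_one₀ h1 (norm_nonneg _) h2) (norm_nonneg _) h3
  -- reduce to `Y' = min Y X ≤ X`
  set Y' := min Y X with hY'
  have hY'Y : Y' ≤ Y := min_le_left _ _
  have hY'X : Y' ≤ X := min_le_right _ _
  have hY'low : Ylow ≤ Y' := le_min hY hYlowX
  have hmono : Msum (twistAF φ t) Y' y ≤ Msum (twistAF φ t) Y y :=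
    Sieve.MatomakiRadziwillL3.Msum_mono hφb hY'Y y
  rw [hsift]
  refine le_trans ?_ hmono
  -- the device at height `Y'`
  have hmask : ∀ p : ℕ, p.Prime → φ p = f p ∨ φ p = 0 := fun p hp => pmul_g_sieveInd_prime I f 𝒥 hS hp
  have hmin' : ∀ u : ℝ, |u| ≤ X → pretentiousDistSq f (fun n : ℕ => (n : ℂ) ^ ((t₁ : ℂ) * Complex.I)) X ≤
      pretentiousDistSq f (fun n : ℕ => (n : ℂ) ^ ((u : ℂ) * Complex.I)) X + 0 := fun u hu => by
    rw [add_zero]; exact hmin u hu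
  set BY : ℝ := Real.log (Real.log Y') - θ * Real.log (Real.log (2 * X)) - 6 with hBY
  have hτ1 : ∀ (s : ℝ) (n : ℕ), ‖(n : ℂ) ^ ((s : ℂ) * Complex.I)‖ ≤ 1 := fun s n =>
    Sieve.MatomakiRadziwillL4A.norm_natCast_cpow_mul_I n s
  have hB' : ∀ τ' : ℝ, 2 ≤ |τ'| → |τ'| ≤ 2 * X →
      BY ≤ pretentiousDistSq 1 (fun n : ℕ => (n : ℂ) ^ ((τ' : ℂ) * Complex.I)) Y' := by
    intro τ' h2 h2X
    have h := hKh τ' (by linarith) h2X Y' (hYlowexp.trans hY'low) (by linarith)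
    have h0 : 0 ≤ pretentiousDistSq 1 (fun n : ℕ => (n : ℂ) ^ ((τ' : ℂ) * Complex.I))
        (Real.exp (Real.log (2 * X) ^ θ) - 1) :=
      Sieve.pretentiousDistSq_nonneg (fun n => by simp) (hτ1 τ') _
    rw [hBY]; linarith
  have htW : |t| + 2 * TH ≤ X := by rw [abs_of_nonneg ht0]; exact htX
  have ht₁' : |t₁| + X ≤ 2 * X := by linarith
  have hdev := Msum_twistAF_sifted_ge (f := ⇑f) hfb (φ := φ) hmask hY'X le_rfl hmin' hB' htW ht₁' hfar y hy
  -- the tail and `B₀ ≤ BY`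
  have hY'4 : 4 ≤ Y' := hYlow4.trans hY'low
  have htail := sum_inv_prime_tail_le_of_log hY'4 hY'X
    (hlog.trans (mul_le_mul_of_nonneg_left (Real.log_le_log (by linarith) hY'low) (by norm_num)))
  have hB₀' := hB₀ Y' hY'low hY'X
  have hc0 : 0 ≤ (Real.sqrt 2 - 1) / 2 := by
    have : (1:ℝ) ≤ Real.sqrt 2 := by
      rw [show (1:ℝ) = Real.sqrt 1 by simp]; exact Real.sqrt_le_sqrt (by norm_num)
    linarith
  have := mul_le_mul_of_nonneg_left hB₀' hc0
  rw [← hBY] at hB₀'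
  linarith [mul_le_mul_of_nonneg_left hB₀' hc0]

/-- **The numerics of the floor** at `θ = 27/40`: with `c = (√2−1)/2`, `M₀ = c ((13/40) log L − 10) − 16` and
`K_M = exp((39/40)(16 + 10c))`, `e^{-(39/40) M₀} ≤ K_M L^{-1/16}` for `L ≥ 1`
(`(39/40)(13/40) c ≥ 1/16` as `c ≥ 1/5`). [folklore] -/
theorem exp_neg_floor_le {L : ℝ} (hL : 1 ≤ L) :
    Real.exp (-(39 / 40) * ((Real.sqrt 2 - 1) / 2 * ((13 / 40) * Real.log L - 10) - 16)) ≤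
      Real.exp ((39 / 40) * (16 + 10 * ((Real.sqrt 2 - 1) / 2))) / L ^ (1 / 16 : ℝ) := by
  set c : ℝ := (Real.sqrt 2 - 1) / 2 with hc
  have hL0 : 0 < L := by linarith
  have hc5 : 1 / 5 ≤ c := by
    have h14 : (1.4 : ℝ) ≤ Real.sqrt 2 := by
      rw [show (1.4:ℝ) = Real.sqrt (1.4 ^ 2) by rw [Real.sqrt_sq (by norm_num)]]
      exact Real.sqrt_le_sqrt (by norm_num)
    rw [hc]; linarith
  have hlogL : 0 ≤ Real.log L := Real.log_nonneg hL
  rw [le_div_iff₀ (Real.rpow_pos_of_pos hL0 _), Real.rpow_def_of_pos hL0, ← Real.exp_add]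
  refine Real.exp_le_exp.2 ?_
  have : (1 / 16 : ℝ) * Real.log L ≤ (39 / 40) * ((13 / 40) * c) * Real.log L := by
    have h1 : (1 / 16 : ℝ) ≤ (39 / 40) * ((13 / 40) * c) := by nlinarith
    exact mul_le_mul_of_nonneg_right h1 hlogL
  nlinarith

/-! ### The Halász input `hR` for `a = f 1_𝒮` on `𝒯₂` -/

set_option maxHeartbeats 1600000 in
/-- (From any Vinogradov–Korobov region `HasVKZeroFreeRegion cVK TVK`, `cVK > 0`.)  **Lemma A.4 for the sifted copies, in the shape `hR` of the `𝒰`-part** (Matomäki–Radziwiłł–Tao 2015, Appendix A: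
"In the region `|t − t₁| ≥ (log X)^{1/16}`, the above implies the following in exactly the same way as [MR]. Lemma A.4
… This was the only part in the proof [MR] that needed `f` to be real-valued").  Assume Khale's theorem.  There is an
absolute `C₃ ≥ 0` such that for all large `X`: for every interval system `I` (attached to any `X₀`), every completely
multiplicative `f : ArithmeticFunction ℂ` with `|f| ≤ 1`, every minimiser `t₁` of `u ↦ 𝔻(f, n^{iu}; X)²` on `|u| ≤ X`,
every `t ∈ [0, X/2]` with `|t − t₁| ≥ (log X)^{1/16}` and every block `v` of the `𝒰`-part
(`H = L^{1/50}`, `[P', Q'] = [e^{L^{97/100}}, e^{L^{99/100}}]`, `L = log X`), the cofactor polynomial of `a = f 1_𝒮`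
satisfies `|R_{v,H}(1+it)| ≤ 2^J · 3 C₃ L^{1/50 − 1/16}`.
Proof: Lemma 5 (`blockCofactorPoly_memCoef_eq`) writes `R_{v,H}` as `∑_𝒥 ± R[f g_𝒥]`; each `f g_𝒥` is multiplicative
and `1`-bounded, and `MatomakiRadziwillL3C.lemma3_complex_of_floor` applies at the scale `X' = X e^{-v/H} ∈ [X^{1/2}, X]`
with the window `T_H = (log X)^{1/16}/4` and the floor of `floor_le_Msum` (`θ = 27/40`,
`M₀ = ((√2−1)/2)((13/40) log L − 10) − 16`, `exp_neg_floor_le`); the right-hand side is `≤ 3 L^{1/50−1/16}`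
(`MatomakiRadziwillU.lemma3_rhs_le`). [cite: MatomakiRadziwillTao2015, Appendix A, Lemma A.4]
[cite: Khale2024, Theorem 1.1] -/
theorem exists_cofactor_bound_of_vk {cVK TVK : ℝ} (hcVK : 0 < cVK) (hVK : HasVKZeroFreeRegion cVK TVK) :
    ∃ C₃ : ℝ, 0 ≤ C₃ ∧ ∀ᶠ X : ℝ in atTop, ∀ (η X₀ : ℝ) (I : SieveIntervalSystem η X₀) (f : ArithmeticFunction ℂ),
      (∀ m n : ℕ, f (m * n) = f m * f n) → f 1 = 1 → (∀ n, ‖f n‖ ≤ 1) →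
      ∀ t₁ : ℝ, |t₁| ≤ X →
      (∀ u : ℝ, |u| ≤ X → pretentiousDistSq f (fun n : ℕ => (n : ℂ) ^ ((t₁ : ℂ) * Complex.I)) X ≤
        pretentiousDistSq f (fun n : ℕ => (n : ℂ) ^ ((u : ℂ) * Complex.I)) X) →
      ∀ t : ℝ, 0 ≤ t → t ≤ X / 2 → Real.log X ^ (1 / 16 : ℝ) ≤ |t - t₁| →
      ∀ v ∈ Icc ⌊Real.log X ^ (1 / 50 : ℝ) * Real.log (Real.exp (Real.log X ^ (97 / 100 : ℝ)))⌋₊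
          ⌊Real.log X ^ (1 / 50 : ℝ) * Real.log (Real.exp (Real.log X ^ (99 / 100 : ℝ)))⌋₊,
        ‖blockCofactorPoly (fun n : ℕ => if I.Mem n then f n else 0) X (Real.exp (Real.log X ^ (97 / 100 : ℝ)))
            (Real.exp (Real.log X ^ (99 / 100 : ℝ))) (Real.log X ^ (1 / 50 : ℝ)) v t‖ ≤
          2 ^ I.J * (3 * C₃ * Real.log X ^ (1 / 50 - 1 / 16 : ℝ)) := by
  classical
  obtain ⟨C, hC0, hL3⟩ := Sieve.MatomakiRadziwillL3C.lemma3_complex_of_floor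
  set c : ℝ := (Real.sqrt 2 - 1) / 2 with hc
  set K_M : ℝ := Real.exp ((39 / 40) * (16 + 10 * c)) with hKM
  have hKM0 : 0 ≤ K_M := (Real.exp_pos _).le
  refine ⟨C * (1 + K_M), by positivity, ?_⟩
  -- eventualities in `X`
  have h2 : Tendsto (fun x : ℝ => 2 * x) atTop atTop := tendsto_id.const_mul_atTop (by norm_num)
  have hθ : (2 : ℝ) / 3 < 27 / 40 := by norm_num
  have hsize := Real.tendsto_log_atTop.eventually
    (Sieve.MatomakiRadziwillProp1.eventually_size (by norm_num : (0 : ℝ) < 1 / 12))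
  have hpow := ((tendsto_rpow_atTop (by norm_num : (0 : ℝ) < 1 - 27 / 40)).comp Real.tendsto_log_atTop).eventually_ge_atTop
    (64 : ℝ)
  filter_upwards [h2.eventually (TwistedPrimeSumTail.pretentiousDistSq_one_twist_tail_ge_of_vk hcVK hVK hθ), hsize, hpow,
    Real.tendsto_log_atTop.eventually_ge_atTop (2 * (4 : ℝ) ^ 16), eventually_ge_atTop (16 : ℝ)]
    with X hKh hsz hpw hL816 hX16
  obtain ⟨-, c2, c3, -, c5, -, -⟩ := hsz
  intro η X₀ I f hf hf1 hfb t₁ ht₁ hmin t ht0 htX hfar v hv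
  set L := Real.log X with hLdef
  set H := L ^ (1 / 50 : ℝ) with hHdef
  have h416 : (4 : ℝ) ^ 16 = 4294967296 := by norm_num
  have hX0 : 0 < X := by linarith
  have hL1 : 1 ≤ L := by rw [h416] at hL816; linarith
  have hL0 : 0 < L := by linarith
  obtain ⟨hL400, h40, hL99, hL97, h97, h9799⟩ := Sieve.MatomakiRadziwillU.Lfacts hL1 c2 c3
  rw [Real.log_exp, Real.log_exp] at hv
  have hH2 : 2 ≤ H := c2
  have hH0 : 0 < H := by linarith
  obtain ⟨hx1, hx2⟩ := Sieve.MatomakiRadziwillU.div_mem_of_mem_Icc hH0 (Real.rpow_nonneg hL0.le _) hv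
  set x : ℝ := (v : ℝ) / H with hxdef
  have hx0 : 0 ≤ x := by positivity
  set X' : ℝ := X * Real.exp (-x) with hX'def
  have hX'0 : 0 < X' := by positivity
  have hlogX' : Real.log X' = L - x := by
    rw [hX'def, Real.log_mul hX0.ne' (Real.exp_pos _).ne', Real.log_exp]; ring
  have hy1 : L / 2 ≤ Real.log X' := by
    rw [hlogX']
    have : L ^ (99 / 100 : ℝ) ≤ L / 40 := by linarith
    linarith
  have hy2 : Real.log X' ≤ L := by rw [hlogX']; linarith
  have hX'X : X' ≤ X := by
    rw [hX'def]
    have : Real.exp (-x) ≤ 1 := by rw [Real.exp_le_one_iff]; linarith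
    nlinarith
  have hX'exp : X' = Real.exp (Real.log X') := (Real.exp_log hX'0).symm
  -- hypotheses of the complex Lemma 3 at the scale `X'`
  have hP2 : 2 ≤ Real.exp (L ^ (97 / 100 : ℝ)) := by
    have := Real.add_one_le_exp (L ^ (97 / 100 : ℝ)); linarith
  have hPQ : Real.exp (L ^ (97 / 100 : ℝ)) ≤ Real.exp (L ^ (99 / 100 : ℝ)) := Real.exp_le_exp.2 h9799
  have hQX' : Real.exp (L ^ (99 / 100 : ℝ)) ≤ X' := by
    rw [hX'exp]
    refine Real.exp_le_exp.2 ?_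
    have : L ^ (99 / 100 : ℝ) ≤ L / 40 := by linarith
    linarith
  have hX'big : Real.exp ((4 : ℝ) ^ 16) ≤ X' := by
    rw [hX'exp]; exact Real.exp_le_exp.2 (by linarith)
  -- the window `T_H = L^{1/16}/4`
  set TH : ℝ := L ^ (1 / 16 : ℝ) / 4 with hTHdef
  have hL16 : (4 : ℝ) ≤ L ^ (1 / 16 : ℝ) := by
    have : (4 : ℝ) = ((4 : ℝ) ^ 16) ^ (1 / 16 : ℝ) := by
      rw [← Real.rpow_natCast, ← Real.rpow_mul (by norm_num)]; norm_num
    rw [this]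
    exact Real.rpow_le_rpow (by positivity) (by linarith) (by norm_num)
  have hTH1 : 1 ≤ TH := by rw [hTHdef]; linarith
  have hTH4 : Real.log X' ^ (1 / 16 : ℝ) ≤ 4 * TH := by
    rw [hTHdef]
    have : Real.log X' ^ (1 / 16 : ℝ) ≤ L ^ (1 / 16 : ℝ) := Real.rpow_le_rpow (by linarith) hy2 (by norm_num)
    linarith
  -- the floor `M₀` and `K_M`
  set M₀ : ℝ := c * ((13 / 40) * Real.log L - 10) - 16 with hM₀def
  have hKMineq : Real.exp (-(39 / 40) * M₀) ≤ K_M / Real.log X' ^ (1 / 16 : ℝ) := by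
    have h1 := exp_neg_floor_le hL1
    rw [← hc, ← hKM] at h1
    refine h1.trans ?_
    have hpos : 0 < Real.log X' ^ (1 / 16 : ℝ) := Real.rpow_pos_of_pos (by linarith) _
    exact div_le_div_of_nonneg_left hKM0 hpos (Real.rpow_le_rpow (by linarith) hy2 (by norm_num))
  -- the floor holds on the fibres of `X'`
  have hYstar : Ystar X' = X' ^ (1 / 4 : ℝ) / 2 := rfl
  have hYexp : Ystar X' = Real.exp (Real.log X' / 4) / 2 := by
    rw [hYstar, Real.rpow_def_of_pos hX'0]; ring_nf
  have hlog2 : Real.log 2 < 1 := by have := Real.log_two_lt_d9; linarith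
  have hlogY : L / 8 - 1 ≤ Real.log (Ystar X') := by
    rw [hYexp, Real.log_div (Real.exp_pos _).ne' two_ne_zero, Real.log_exp]; linarith
  have hYlow4 : 4 ≤ Ystar X' := by
    rw [hYexp]
    have : (8 : ℝ) ≤ Real.exp (Real.log X' / 4) := by
      have := Real.add_one_le_exp (Real.log X' / 4); rw [h416] at hL816; linarith
    linarith
  have hYlowX' : Ystar X' ≤ X' := by
    rw [hYstar]
    have h14 : X' ^ (1 / 4 : ℝ) ≤ X' := by
      have hX'1 : 1 ≤ X' := by
        have := Real.add_one_le_exp (Real.log X'); rw [← hX'exp] at this; linarith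
      calc X' ^ (1 / 4 : ℝ) ≤ X' ^ (1 : ℝ) := Real.rpow_le_rpow_of_exponent_le hX'1 (by norm_num)
        _ = X' := Real.rpow_one X'
    have : 0 ≤ X' ^ (1 / 4 : ℝ) := by positivity
    linarith
  have hYlowX : Ystar X' ≤ X := hYlowX'.trans hX'X
  -- `exp((log 2X)^θ) ≤ Y_*`: `(log 2X)^θ ≤ (2L)^θ ≤ 2L/L^{1-θ}·… ≤ L/16 ≤ L/8 - 1 - log 2`
  have hlog2X : Real.log (2 * X) ≤ 2 * L := by
    rw [Real.log_mul two_ne_zero hX0.ne']; rw [h416] at hL816; linarith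
  have hlog2X1 : 1 ≤ Real.log (2 * X) := by
    rw [Real.log_mul two_ne_zero hX0.ne']; have : 0 < Real.log 2 := Real.log_pos one_lt_two; linarith
  have hpw' : (64 : ℝ) ≤ L ^ (1 - 27 / 40 : ℝ) := hpw
  have hθpow : Real.log (2 * X) ^ (27 / 40 : ℝ) ≤ L / 16 := by
    have h1 : Real.log (2 * X) ^ (27 / 40 : ℝ) ≤ (2 * L) ^ (27 / 40 : ℝ) :=
      Real.rpow_le_rpow (by linarith) hlog2X (by norm_num)
    have h2 : (2 * L) ^ (27 / 40 : ℝ) * (2 * L) ^ (1 - 27 / 40 : ℝ) = 2 * L := by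
      rw [← Real.rpow_add (by linarith)]; norm_num
    have h3 : (64 : ℝ) ≤ (2 * L) ^ (1 - 27 / 40 : ℝ) :=
      hpw'.trans (Real.rpow_le_rpow hL0.le (by linarith) (by norm_num))
    have h4 : 0 ≤ (2 * L) ^ (27 / 40 : ℝ) := by positivity
    nlinarith
  have hYlowexp : Real.exp (Real.log (2 * X) ^ (27 / 40 : ℝ)) ≤ Ystar X' := by
    have : Real.exp (Real.log (2 * X) ^ (27 / 40 : ℝ)) ≤ Real.exp (Real.log (Ystar X')) :=
      Real.exp_le_exp.2 (by rw [h416] at hL816; linarith)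
    rwa [Real.exp_log (by linarith)] at this
  have hlog16 : Real.log X ≤ 16 * Real.log (Ystar X') := by rw [← hLdef]; rw [h416] at hL816; linarith
  -- `B₀ = (13/40) log L - 10 ≤ log log Y - θ log log 2X - 6` on `[Y_*, X]`
  have hB₀ : ∀ Y : ℝ, Ystar X' ≤ Y → Y ≤ X →
      (13 / 40) * Real.log L - 10 ≤ Real.log (Real.log Y) - 27 / 40 * Real.log (Real.log (2 * X)) - 6 := by
    intro Y hY _
    have h1 : Real.log L - Real.log 16 ≤ Real.log (Real.log Y) := by
      have hlogY' : L / 16 ≤ Real.log Y := by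
        have := Real.log_le_log (by linarith) hY; rw [h416] at hL816; linarith
      have := Real.log_le_log (by positivity) hlogY'
      rwa [Real.log_div hL0.ne' (by norm_num)] at this
    have h2 : Real.log (Real.log (2 * X)) ≤ Real.log L + 1 := by
      have h21 : Real.log (2 * X) ≤ L * Real.exp 1 := by
        have := Real.add_one_le_exp (1 : ℝ); nlinarith
      calc Real.log (Real.log (2 * X)) ≤ Real.log (L * Real.exp 1) := Real.log_le_log (by linarith) h21
        _ = Real.log L + 1 := by rw [Real.log_mul hL0.ne' (Real.exp_pos 1).ne', Real.log_exp]
    have h3 : Real.log 16 = 4 * Real.log 2 := by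
      rw [show (16:ℝ) = 2 ^ 4 by norm_num, Real.log_pow]; norm_num
    have hlog2d : Real.log 2 < 0.6931471808 := Real.log_two_lt_d9
    have hlogL0 := Real.log_nonneg hL1
    linarith
  -- geometry of the window
  have hTHX : t + 2 * TH ≤ X := by
    have : TH ≤ L := by
      rw [hTHdef]
      have : L ^ (1 / 16 : ℝ) ≤ L := by
        calc L ^ (1 / 16 : ℝ) ≤ L ^ (1 : ℝ) := Real.rpow_le_rpow_of_exponent_le hL1 (by norm_num)
          _ = L := Real.rpow_one L
      linarith
    have hLX : L ≤ X / 4 := by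
      -- `log X ≤ X/4`: from `e^{L} ≥ 1 + L + L²/2` and `L ≥ 400`
      have hexpL : Real.exp L = X := by rw [hLdef, Real.exp_log hX0]
      have hq := Real.quadratic_le_exp_of_nonneg hL0.le
      rw [hexpL] at hq
      nlinarith [hL400]
    linarith
  have hfar' : 2 * TH + 2 ≤ |t - t₁| := by
    rw [hTHdef]; linarith
  -- Lemma 5 and the triangle inequality
  rw [blockCofactorPoly_memCoef_eq I f _ _ _ H v t]
  have hxH : -((v : ℝ) / H) = -x := by rw [hxdef]
  simp only [hxH]
  refine (norm_sum_le _ _).trans ?_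
  have hterm : ∀ 𝒥 ∈ (Icc 1 I.J).powerset,
      ‖((-1 : ℝ) ^ #𝒥) • ∑ m ∈ Icc ⌈X * Real.exp (-x)⌉₊ ⌊2 * (X * Real.exp (-x))⌋₊,
          ((I.g 𝒥 m : ℂ) * f m) * (m : ℂ) ^ (-(1 + (t : ℂ) * Complex.I)) /
            ((primeDivisorsIn (Real.exp (L ^ (97 / 100 : ℝ))) (Real.exp (L ^ (99 / 100 : ℝ))) m : ℂ) + 1)‖ ≤
        3 * (C * (1 + K_M)) * L ^ (1 / 50 - 1 / 16 : ℝ) := by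
    intro 𝒥 _
    rw [norm_smul, norm_pow, norm_neg, norm_one, one_pow, one_mul]
    obtain ⟨hmult, hbd⟩ := pmul_g_props I hf hf1 hfb 𝒥
    set fJ := f.pmul (toComplexAF (I.g 𝒥)) with hfJ
    -- the floor on the fibres of `X'`
    have hfloor : ∀ Y : ℝ, Ystar X' ≤ Y → ∀ y : ℝ, |y| ≤ 2 * TH →
        M₀ ≤ Msum (siftedTwistC fJ (primesPQ (Real.exp (L ^ (97 / 100 : ℝ))) (Real.exp (L ^ (99 / 100 : ℝ)))) t) Y y := by
      intro Y hY y hy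
      have h := floor_le_Msum hfb I 𝒥 (S := primesPQ (Real.exp (L ^ (97 / 100 : ℝ))) (Real.exp (L ^ (99 / 100 : ℝ))))
        primesPQ_prime (θ := 27 / 40) (B₀ := (13 / 40) * Real.log L - 10) hKh hmin ht₁ ht0 hTHX hfar' hYlowexp hYlow4
        hYlowX hlog16 hB₀ Y hY y hy
      rw [hM₀def, hc]
      exact h
    have h := hL3 fJ hmult hbd X' _ _ t TH M₀ K_M hP2 hPQ hQX' hX'big hTH1 hTH4 hKM0 hKMineq hfloor
    rw [Real.log_exp, Real.log_exp] at h
    have hsum : ∑ n ∈ Icc ⌈X'⌉₊ ⌊2 * X'⌋₊, fJ n * (n : ℂ) ^ (-(1 + (t : ℂ) * Complex.I)) /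
        ((primeDivisorsIn (Real.exp (L ^ (97 / 100 : ℝ))) (Real.exp (L ^ (99 / 100 : ℝ))) n : ℂ) + 1) =
        ∑ m ∈ Icc ⌈X * Real.exp (-x)⌉₊ ⌊2 * (X * Real.exp (-x))⌋₊,
          ((I.g 𝒥 m : ℂ) * f m) * (m : ℂ) ^ (-(1 + (t : ℂ) * Complex.I)) /
            ((primeDivisorsIn (Real.exp (L ^ (97 / 100 : ℝ))) (Real.exp (L ^ (99 / 100 : ℝ))) m : ℂ) + 1) := by
      refine sum_congr rfl fun m _ => ?_
      rw [hfJ, ArithmeticFunction.pmul_apply, toComplexAF_apply, mul_comm (f m)]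
    rw [hsum] at h
    refine h.trans ?_
    have hB := Sieve.MatomakiRadziwillU.lemma3_rhs_le hL1 c2 c3 c5 hy1 hy2
    calc C * (1 + K_M) * (L ^ (99 / 100 : ℝ) / (Real.log X' ^ (1 / 16 : ℝ) * L ^ (97 / 100 : ℝ)) +
          Real.log X' * Real.exp (-(Real.log X' / (3 * L ^ (99 / 100 : ℝ))) * Real.log (Real.log X' / L ^ (99 / 100 : ℝ))))
        ≤ C * (1 + K_M) * (3 * L ^ (1 / 50 - 1 / 16 : ℝ)) := mul_le_mul_of_nonneg_left hB (by positivity)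
      _ = 3 * (C * (1 + K_M)) * L ^ (1 / 50 - 1 / 16 : ℝ) := by ring
  refine (sum_le_sum hterm).trans ?_
  rw [sum_const, nsmul_eq_mul, card_powerset, Nat.card_Icc, Nat.add_sub_cancel]
  push_cast
  rfl

/-- **Lemma A.4 for the sifted copies, in the shape `hR` of the `𝒰`-part** (Matomäki–Radziwiłł–Tao 2015, Appendix A:
"In the region `|t − t₁| ≥ (log X)^{1/16}`, the above implies the following in exactly the same way as [MR]. Lemma A.4
… This was the only part in the proof [MR] that needed `f` to be real-valued").  Assume Khale's theorem.  There is an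
absolute `C₃ ≥ 0` such that for all large `X`: for every interval system `I` (attached to any `X₀`), every completely
multiplicative `f : ArithmeticFunction ℂ` with `|f| ≤ 1`, every minimiser `t₁` of `u ↦ 𝔻(f, n^{iu}; X)²` on `|u| ≤ X`,
every `t ∈ [0, X/2]` with `|t − t₁| ≥ (log X)^{1/16}` and every block `v` of the `𝒰`-part
(`H = L^{1/50}`, `[P', Q'] = [e^{L^{97/100}}, e^{L^{99/100}}]`, `L = log X`), the cofactor polynomial of `a = f 1_𝒮`
satisfies `|R_{v,H}(1+it)| ≤ 2^J · 3 C₃ L^{1/50 − 1/16}`.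
Proof: Lemma 5 (`blockCofactorPoly_memCoef_eq`) writes `R_{v,H}` as `∑_𝒥 ± R[f g_𝒥]`; each `f g_𝒥` is multiplicative
and `1`-bounded, and `MatomakiRadziwillL3C.lemma3_complex_of_floor` applies at the scale `X' = X e^{-v/H} ∈ [X^{1/2}, X]`
with the window `T_H = (log X)^{1/16}/4` and the floor of `floor_le_Msum` (`θ = 27/40`,
`M₀ = ((√2−1)/2)((13/40) log L − 10) − 16`, `exp_neg_floor_le`); the right-hand side is `≤ 3 L^{1/50−1/16}`
(`MatomakiRadziwillU.lemma3_rhs_le`). [cite: MatomakiRadziwillTao2015, Appendix A, Lemma A.4]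
[cite: Khale2024, Theorem 1.1] -/
theorem exists_cofactor_bound (hK : Khale2024_zeroFreeRegion) :
    ∃ C₃ : ℝ, 0 ≤ C₃ ∧ ∀ᶠ X : ℝ in atTop, ∀ (η X₀ : ℝ) (I : SieveIntervalSystem η X₀) (f : ArithmeticFunction ℂ),
      (∀ m n : ℕ, f (m * n) = f m * f n) → f 1 = 1 → (∀ n, ‖f n‖ ≤ 1) →
      ∀ t₁ : ℝ, |t₁| ≤ X →
      (∀ u : ℝ, |u| ≤ X → pretentiousDistSq f (fun n : ℕ => (n : ℂ) ^ ((t₁ : ℂ) * Complex.I)) X ≤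
        pretentiousDistSq f (fun n : ℕ => (n : ℂ) ^ ((u : ℂ) * Complex.I)) X) →
      ∀ t : ℝ, 0 ≤ t → t ≤ X / 2 → Real.log X ^ (1 / 16 : ℝ) ≤ |t - t₁| →
      ∀ v ∈ Icc ⌊Real.log X ^ (1 / 50 : ℝ) * Real.log (Real.exp (Real.log X ^ (97 / 100 : ℝ)))⌋₊
          ⌊Real.log X ^ (1 / 50 : ℝ) * Real.log (Real.exp (Real.log X ^ (99 / 100 : ℝ)))⌋₊,
        ‖blockCofactorPoly (fun n : ℕ => if I.Mem n then f n else 0) X (Real.exp (Real.log X ^ (97 / 100 : ℝ)))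
            (Real.exp (Real.log X ^ (99 / 100 : ℝ))) (Real.log X ^ (1 / 50 : ℝ)) v t‖ ≤
          2 ^ I.J * (3 * C₃ * Real.log X ^ (1 / 50 - 1 / 16 : ℝ))  :=
  exists_cofactor_bound_of_vk (by norm_num) (hasVKZeroFreeRegion_of_khale hK)

end MRT2015

end Literature.NumberTheory.LFunctions
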